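import Mathlib
import Literature.AlgebraicGeometry.Resolution.TameTowerPGroupTowers
import Literature.NumberTheory.GaloisRepresentations.IntegralGaloisAction
import Summits.Langlands.Langlands.Theses.DyadicOddResidue

/-!
# A `p`-extension of `ℚ` unramified outside `p` has a single prime above `p`
# (first lemma of crux idea `everything-local-at-two`, crux `DyadicEisensteinFM`, stmt-Langlands-18741)

Helper file for the crux `Summit.Langlands.Langlands.Theses.DyadicOddResidue.DyadicEisensteinFM`
(Fontaine–Mazur at `ℓ = 2`, residually reducible odd regular `ρ : Γ_ℚ → GL₂(ℚ̄₂)`).  The crux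
ideas `everything-local-at-two`, `koch-pro2-fern` and `koch-free-product-assembly`
(`Cruxes/DyadicEisensteinFM/Ideas/`) all start from the fact that in the maximal pro-`2`
extension of `ℚ` unramified outside `{2, ∞}` **the decomposition group at `2` is everything**:
after the Teichmüller twist a residually reducible `ρ` has pro-`2` image, so `ρ(G_{ℚ₂}) = ρ(G_ℚ)`
and complex conjugation becomes a `2`-adic LOCAL element.  At finite level this is the statement
proved here (it was the one `sorry` of the ideation sketch `Cruxes/DyadicEisensteinFM/SketchIdeator2.lean`,
`unique_prime_above_two`, with the signature kept verbatim):

* `eq_of_liesOver_of_isPGroup` — if `K/ℚ` is finite Galois with Galois group a `p`-group and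
  `K` is unramified at every prime `ℓ ≠ p` (`ℓ ∤ d_K`), then `𝓞 K` has exactly one prime above `p`.
* `unique_prime_above_two` — the case `p = 2` in the sketch's signature.

## Proof

Let `G = Gal(K/ℚ)` and suppose `P ≠ Q` lie over `p`.  By transitivity (`Ideal.exists_smul_eq_of_isGaloisGroup`)
the decomposition group `D = Stab_G(P)` is proper, hence inside a maximal subgroup `M`, which in a
finite `p`-group is normal of index `p` (tree lemma
`Literature.AlgebraicGeometry.Resolution.index_eq_of_isCoatom`).  Its fixed field `k` is Galois of
degree `p` over `ℚ`, and for `τ ∉ M` the primes `P ∩ 𝓞 k ≠ τP ∩ 𝓞 k` (else `Gal(K/k) = M` moves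
`P` to `τP`, putting `τ` in `M·D = M`).  So `k` has `≥ 2`, hence `p`, primes above `p`, each with
`e = f = 1` (fundamental identity `r·e·f = p`, Mathlib
`Ideal.ncard_primesOver_mul_ramificationIdxIn_mul_inertiaDegIn`); and `k ⊆ K` is unramified at
every `ℓ ≠ p` (Dedekind's criterion `NumberField.not_dvd_discr_iff_forall_liesOver` for `K`, and
multiplicativity of ramification indices in `ℤ ⊆ 𝓞 k ⊆ 𝓞 K`).  Thus `k ≠ ℚ` is unramified
everywhere, contradicting Minkowski (`NumberField.exists_not_isUnramifiedAt_int_of_isGalois`).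

Classical; e.g. the Frattini-quotient form "`G_{ℚ,{p,∞}}(p)` has `D_p = G`" in Koch, *Galois theory
of p-extensions*, §11, and for `p = 2` the remark that `2` ramifies in `ℚ(i)`, `ℚ(√±2)`.
-/

set_option linter.dupNamespace false -- project-wide option (lakefile weak.linter.dupNamespace); `Summit.Langlands.Langlands` is the mandated namespace

namespace Summit.Langlands.Langlands.Theorems.DyadicEisensteinFM

open NumberField Ideal Module
open scoped Pointwise

/-- **A `p`-extension of `ℚ` unramified outside `p` has exactly one prime above `p`.**  If `K/ℚ`
is a finite Galois extension whose Galois group is a `p`-group and no prime `ℓ ≠ p` divides the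
discriminant of `K`, then any two primes of `𝓞 K` lying over `p` coincide (equivalently: the
decomposition group at `p` is the whole Galois group).  See the module docstring for the proof
(maximal subgroups of `p`-groups have index `p`; a degree-`p` subfield with two primes above `p`
would be unramified everywhere, contradicting Minkowski). -/
theorem eq_of_liesOver_of_isPGroup {p : ℕ} (hp : p.Prime) (K : Type*) [Field K] [NumberField K]
    [IsGalois ℚ K] (hG : IsPGroup p (K ≃ₐ[ℚ] K))
    (hunr : ∀ ℓ : ℕ, ℓ.Prime → ℓ ≠ p → ¬ ((ℓ : ℤ) ∣ NumberField.discr K))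
    (P Q : Ideal (𝓞 K)) [P.IsPrime] [Q.IsPrime]
    [hP : P.LiesOver (Ideal.span {(p : ℤ)})] [hQ : Q.LiesOver (Ideal.span {(p : ℤ)})] :
    P = Q := by
  classical
  haveI : Fact p.Prime := ⟨hp⟩
  have hpZ : Prime (p : ℤ) := Nat.prime_iff_prime_int.mp hp
  set G := K ≃ₐ[ℚ] K
  by_contra hPQ
  -- the decomposition group of `P` is a proper subgroup (transitivity on the primes over `p`)
  obtain ⟨σ, hσ⟩ := Ideal.exists_smul_eq_of_isGaloisGroup (Ideal.span {(p : ℤ)}) P Q G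
  set D : Subgroup G := P.decompositionSubgroup G with hD
  have hσD : σ ∉ D := by
    intro h
    rw [Ideal.mem_decompositionSubgroup_iff] at h
    exact hPQ (h.symm.trans hσ)
  have hDtop : D ≠ ⊤ := fun h => hσD (h ▸ Subgroup.mem_top σ)
  -- a maximal subgroup `M ⊇ D`: normal of index `p`
  obtain ⟨M, hMc, hDM⟩ := (eq_top_or_exists_le_coatom D).resolve_left hDtop
  obtain ⟨hMn, hMi⟩ := Literature.AlgebraicGeometry.Resolution.index_eq_of_isCoatom hG hMc
  obtain ⟨τ, hτ⟩ : ∃ τ : G, τ ∉ M := by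
    by_contra! h
    exact hMc.1 (eq_top_iff.mpr fun x _ => h x)
  -- its fixed field `k`, Galois of degree `p` over `ℚ`
  let k : IntermediateField ℚ K := IntermediateField.fixedField M
  haveI : IsGaloisGroup M k K := IsGaloisGroup.subgroup G ℚ K M
  haveI : M.Normal := hMn
  haveI : IsGalois ℚ k := IsGalois.of_fixedField_normal_subgroup M
  have hkK : finrank k K = Nat.card M := IsGaloisGroup.finrank_fixedPoints_eq_card_subgroup G ℚ K M
  have hkp : finrank ℚ k = p := by
    have h1 := Module.finrank_mul_finrank ℚ k K
    rw [hkK, ← IsGaloisGroup.card_eq_finrank G ℚ K, ← Subgroup.card_mul_index M, hMi] at h1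
    have hpos : 0 < Nat.card M := Nat.card_pos
    nlinarith [h1]
  -- two distinct primes of `𝓞 k` over `p`: `P ∩ 𝓞 k` and `τP ∩ 𝓞 k`
  haveI hGalM : IsGaloisGroup M (𝓞 k) (𝓞 K) :=
    IsGaloisGroup.of_isFractionRing M (𝓞 k) (𝓞 K) k K
  have hne : P.under (𝓞 k) ≠ (τ • P).under (𝓞 k) := by
    intro heq
    haveI : (τ • P).LiesOver (P.under (𝓞 k)) := ⟨heq⟩
    obtain ⟨m, hm⟩ := Ideal.exists_smul_eq_of_isGaloisGroup (P.under (𝓞 k)) P (τ • P) M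
    have hm' : (m : G) • P = τ • P := hm
    have hmem : τ⁻¹ * (m : G) ∈ D := by
      rw [Ideal.mem_decompositionSubgroup_iff, mul_smul, hm', inv_smul_smul]
    exact hτ (inv_mem_iff.mp ((M.mul_mem_cancel_right m.2).mp (hDM hmem)))
  -- `k ≠ ℚ` is Galois, so some rational prime `ℓ` is ramified at EVERY prime of `𝓞 k` above it
  obtain ⟨ℓ, hℓ, hram⟩ := NumberField.exists_not_isUnramifiedAt_int_of_isGalois (K := k)
    (𝒪 := 𝓞 k) (by rw [hkp]; exact hp.one_lt)
  have hℓZ : Prime (ℓ : ℤ) := Nat.prime_iff_prime_int.mp hℓ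
  by_cases hℓp : ℓ = p
  · subst hℓp
    -- `ℓ = p`: but `P ∩ 𝓞 k` is unramified over `p` (fundamental identity with `≥ 2` primes)
    have hpZmem : (ℓ : ℤ) ∈ P.under ℤ := by
      rw [← hP.over]; exact Ideal.mem_span_singleton_self _
    have hpK : (ℓ : 𝓞 K) ∈ P := by
      have := Ideal.mem_comap.mp hpZmem
      simpa using this
    have hmem : (ℓ : 𝓞 k) ∈ P.under (𝓞 k) := by
      rw [Ideal.mem_comap, map_natCast]; exact hpK
    refine hram (P.under (𝓞 k)) inferInstance hmem ?_
    haveI : (Ideal.span {(ℓ : ℤ)}).IsPrime := (Ideal.span_singleton_prime hℓZ.ne_zero).mpr hℓZ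
    have hfi := Ideal.ncard_primesOver_mul_ramificationIdxIn_mul_inertiaDegIn
      (Ideal.span {(ℓ : ℤ)}) (𝓞 k) (k ≃ₐ[ℚ] k)
    rw [IsGaloisGroup.card_eq_finrank (k ≃ₐ[ℚ] k) ℚ k, hkp] at hfi
    haveI h1 : (P.under (𝓞 k)).LiesOver (Ideal.span {(ℓ : ℤ)}) :=
      Ideal.LiesOver.tower_bot P (P.under (𝓞 k)) (Ideal.span {(ℓ : ℤ)})
    haveI h1' : ((τ • P).under (𝓞 k)).LiesOver (Ideal.span {(ℓ : ℤ)}) :=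
      Ideal.LiesOver.tower_bot (τ • P) ((τ • P).under (𝓞 k)) (Ideal.span {(ℓ : ℤ)})
    have hmemS : P.under (𝓞 k) ∈ Ideal.primesOver (Ideal.span {(ℓ : ℤ)}) (𝓞 k) :=
      ⟨inferInstance, h1⟩
    have hmemS' : (τ • P).under (𝓞 k) ∈ Ideal.primesOver (Ideal.span {(ℓ : ℤ)}) (𝓞 k) :=
      ⟨inferInstance, h1'⟩
    have hncard : 2 ≤ (Ideal.primesOver (Ideal.span {(ℓ : ℤ)}) (𝓞 k)).ncard := by
      have hfin : (Ideal.primesOver (Ideal.span {(ℓ : ℤ)}) (𝓞 k)).Finite := by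
        by_contra hinf
        rw [Set.Infinite.ncard (Set.not_finite.mp hinf)] at hfi
        simp only [zero_mul] at hfi
        exact hp.ne_zero hfi.symm
      have := Set.ncard_le_ncard (s := {P.under (𝓞 k), (τ • P).under (𝓞 k)}) (by
        intro x hx
        rcases hx with rfl | rfl
        · exact hmemS
        · exact hmemS') hfin
      rwa [Set.ncard_pair hne] at this
    have hprod : Ideal.ramificationIdxIn (Ideal.span {(ℓ : ℤ)}) (𝓞 k) *
        Ideal.inertiaDegIn (Ideal.span {(ℓ : ℤ)}) (𝓞 k) = 1 := by
      have hdvd : (Ideal.primesOver (Ideal.span {(ℓ : ℤ)}) (𝓞 k)).ncard ∣ ℓ := ⟨_, hfi.symm⟩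
      rcases (Nat.dvd_prime hp).mp hdvd with h1 | h2
      · omega
      · rw [h2] at hfi
        nlinarith [hfi, hp.pos]
    have he : Ideal.ramificationIdxIn (Ideal.span {(ℓ : ℤ)}) (𝓞 k) = 1 :=
      Nat.eq_one_of_mul_eq_one_right hprod
    rw [← Ideal.ramificationIdx_eq_one_iff,
      ← Ideal.ramificationIdxIn_eq_ramificationIdx (Ideal.span {(ℓ : ℤ)}) (P.under (𝓞 k))
        (k ≃ₐ[ℚ] k), he]
  · -- `ℓ ≠ p`: `K`, hence `k`, is unramified at `ℓ`
    haveI hℓmax : (Ideal.span {(ℓ : ℤ)}).IsMaximal :=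
      ((Ideal.span_singleton_prime hℓZ.ne_zero).mpr hℓZ).isMaximal
        (by simpa using hℓZ.ne_zero)
    obtain ⟨q, hqmax, hq⟩ := Ideal.exists_maximal_ideal_liesOver_of_isIntegral (S := 𝓞 k)
      (Ideal.span {(ℓ : ℤ)})
    haveI := hq
    have hℓq : (ℓ : 𝓞 k) ∈ q := by
      have hz : (ℓ : ℤ) ∈ q.under ℤ := by rw [← hq.over]; exact Ideal.mem_span_singleton_self _
      have := Ideal.mem_comap.mp hz
      simpa using this
    refine hram q hqmax.isPrime hℓq ?_
    obtain ⟨Q₀, hQ₀max, hQ₀⟩ := Ideal.exists_maximal_ideal_liesOver_of_isIntegral (S := 𝓞 K) q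
    haveI := hQ₀
    haveI : Q₀.LiesOver (Ideal.span {(ℓ : ℤ)}) := Ideal.LiesOver.trans Q₀ q _
    have hunrK : Algebra.IsUnramifiedAt ℤ Q₀ :=
      (NumberField.not_dvd_discr_iff_forall_liesOver K (𝓞 K) hℓZ).mp (hunr ℓ hℓ hℓp) Q₀ hQ₀max
        inferInstance
    have htower := Ideal.ramificationIdx_tower (R := ℤ) q Q₀
    rw [(Ideal.ramificationIdx_eq_one_iff).mpr hunrK] at htower
    rw [← Ideal.ramificationIdx_eq_one_iff]
    exact Nat.eq_one_of_mul_eq_one_right htower.symm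

/-- **`2` does not split in a `2`-extension of `ℚ` unramified at the odd primes** — the first
lemma of crux idea `everything-local-at-two` (and `P2` of `koch-pro2-fern`) in the signature of the
ideation sketch `Cruxes/DyadicEisensteinFM/SketchIdeator2.lean`: if `K/ℚ` is Galois with Galois
group a `2`-group and `K` is unramified at every odd prime, then there is exactly one prime of `𝓞 K`
above `2` (Frattini form: the maximal elementary-abelian subextension lies in `ℚ(ζ₈)`, in which `2`
is totally ramified).  Consequence used by the cards: every continuous `ρ : G_ℚ → GL₂(ℤ̄₂)` with
trivial residual semisimplification and unramified outside `2` satisfies `ρ(G_{ℚ₂}) = ρ(G_ℚ)`, and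
complex conjugation lies in the decomposition group at `2` of the pro-`2` quotient. -/
theorem unique_prime_above_two (K : Type) [Field K] [NumberField K] [IsGalois ℚ K]
    (h2 : IsPGroup 2 (K ≃ₐ[ℚ] K))
    (hunr : ∀ p : ℕ, p.Prime → p ≠ 2 → ¬ ((p : ℤ) ∣ NumberField.discr K))
    (P Q : Ideal (𝓞 K)) [P.IsPrime] [Q.IsPrime]
    (hP : P.LiesOver (Ideal.span {(2 : ℤ)})) (hQ : Q.LiesOver (Ideal.span {(2 : ℤ)})) :
    P = Q :=
  eq_of_liesOver_of_isPGroup Nat.prime_two K h2 hunr P Q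

end Summit.Langlands.Langlands.Theorems.DyadicEisensteinFM
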